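import Mathlib
import Summits.ValiantsHypothesis.ValiantsHypothesis.Theorems.NewtonUnitEquationsNewtonTauWeakCornerDefs
import Summits.ValiantsHypothesis.ValiantsHypothesis.Theorems.NewtonUnitEquationsNewtonTauWeakCornerWords

/-!
# `NewtonTauWeak` (stmt-ValiantsHypothesis-5904), stub `fixedKCoincidence_t2_K3`: preparations for the
# dead-corner lemma

Support file (siege k16).  Word combinatorics for the second local configuration of the `K = 3` analysis
(see `…FixedK3k16DeadCorner.lean`): the off-letter weight bound (`k16_weight_ge_offletter`: a word of a
separated product with a nonzero letter off `e₁` weighs at least the lightest order point off `e₁`, with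
equality only for that pure word), words supported on one letter, words with two letters have a letter off
`e₁`, a `W`-word contributing to an off-ray point has a letter off `e₁`, and the two fibre sums at the decisive
points: `fib_U` at the pair point `o·E_{e₁} + o₂·E_{e₂}` and `fib_W` at the ray point `o_ê·E_ê`. [folklore]
-/

set_option linter.dupNamespace false

noncomputable section

open scoped BigOperators Polynomial

namespace Summit.ValiantsHypothesis.ValiantsHypothesis.Theorems.NewtonTauWeakFixedK3k16

open Summit.ValiantsHypothesis.ValiantsHypothesis.Theorems.NewtonTauWeakCorner

/-! ## Words -/

/-- A word vanishing off `e₁` is the pure word `n(e₁)·[e₁]`. [folklore] -/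
theorem eq_single_of_forall_ne {s : ℕ} (e₁ : Fin s) (n : Fin s → ℕ) (hn : ∀ e, e ≠ e₁ → n e = 0) :
    n = Pi.single e₁ (n e₁) := by
  funext x
  by_cases hx : x = e₁
  · subst hx; simp
  · simp [hx, hn x hx]

/-- A word with two nonzero letters has a nonzero letter off `e₁`. [folklore] -/
theorem exists_letter_ne {s : ℕ} (e₁ : Fin s) (n : Fin s → ℕ)
    (h2 : 2 ≤ (Finset.univ.filter fun x => n x ≠ 0).card) : ∃ e, e ≠ e₁ ∧ n e ≠ 0 := by
  classical
  obtain ⟨x, hx, y, hy, hxy⟩ :=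
    Finset.one_lt_card.mp (by omega : 1 < (Finset.univ.filter fun x => n x ≠ 0).card)
  have hx' := (Finset.mem_filter.mp hx).2
  have hy' := (Finset.mem_filter.mp hy).2
  by_cases hxe : x = e₁
  · exact ⟨y, fun h => hxy (by rw [hxe, h]), hy'⟩
  · exact ⟨x, hxe, hx'⟩

/-- A word `n` with `o·E_{e₁} + push n = z` for an OFF-RAY `z` has a nonzero letter off `e₁` (`o ≥ 1`).
[folklore] -/
theorem exists_letter_ne_of_offRay {s : ℕ} (E : Fin s → Fin 2 → ℤ) (e₁ : Fin s) {o : ℕ} (ho : 1 ≤ o)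
    {z : Fin 2 → ℤ} (hzoff : ¬ OnRay E z) (n : Fin s → ℕ) (hpush : (o : ℤ) • E e₁ + push E n = z) :
    ∃ e, e ≠ e₁ ∧ n e ≠ 0 := by
  classical
  by_contra hall
  push Not at hall
  apply hzoff
  have hn1 := eq_single_of_forall_ne e₁ n hall
  rw [hn1, push_single, ← add_smul] at hpush
  refine ⟨e₁, o + n e₁, by omega, ?_⟩
  rw [← hpush]; push_cast; rfl

/-! ## The off-letter weight bound -/

/-- **Off-letter weight bound.** If `ê` minimises `o_e⟨w,E_e⟩` over the active directions `e ≠ e₁` of a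
separated product `W`, then every word with nonzero separated coefficient and a nonzero letter `e ≠ e₁`
weighs at least `o_ê ⟨w, E_ê⟩`, with equality only for the pure word `o_ê [ê]`. [folklore] -/
theorem k16_weight_ge_offletter {s : ℕ} (E : Fin s → Fin 2 → ℤ) (w : Fin 2 → ℝ)
    (hw : ∀ e, 0 < wt w (E e)) (hgen : Function.Injective (wt w))
    (hE : ∀ e e' : Fin s, ∀ k k' : ℕ, 1 ≤ k → (k : ℤ) • E e = (k' : ℤ) • E e' → e = e')
    (W : Fin s → ℂ[X]) (oW : Fin s → ℕ) (hoW : ∀ e, Active (W e) → IsOrder (W e) (oW e))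
    (e₁ ê : Fin s) (hê : Active (W ê))
    (hmin : ∀ e, e ≠ e₁ → Active (W e) → (oW ê : ℝ) * wt w (E ê) ≤ (oW e : ℝ) * wt w (E e))
    (n : Fin s → ℕ) (hn : sepCoeff W n ≠ 0) (e : Fin s) (hee : e ≠ e₁) (hne : n e ≠ 0) :
    (oW ê : ℝ) * wt w (E ê) ≤ wt w (push E n) ∧
      ((oW ê : ℝ) * wt w (E ê) = wt w (push E n) → n = Pi.single ê (oW ê)) := by
  classical
  have hact : Active (W e) := ⟨n e, Nat.one_le_iff_ne_zero.mpr hne, sepCoeff_ne_zero_apply hn e⟩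
  have hord : oW e ≤ n e := (hoW e hact).le_of_coeff_ne_zero (Nat.one_le_iff_ne_zero.mpr hne)
    (sepCoeff_ne_zero_apply hn e)
  have hterm : ∀ x ∈ Finset.univ, (0 : ℝ) ≤ (n x : ℝ) * wt w (E x) :=
    fun x _ => mul_nonneg (by positivity) (hw x).le
  have h1 : (oW ê : ℝ) * wt w (E ê) ≤ (oW e : ℝ) * wt w (E e) := hmin e hee hact
  have h2 : (oW e : ℝ) * wt w (E e) ≤ (n e : ℝ) * wt w (E e) :=
    mul_le_mul_of_nonneg_right (by exact_mod_cast hord) (hw e).le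
  have h3 : (n e : ℝ) * wt w (E e) ≤ wt w (push E n) := by
    rw [wt_push]; exact Finset.single_le_sum hterm (Finset.mem_univ e)
  refine ⟨h1.trans (h2.trans h3), fun heq => ?_⟩
  have h3' : (n e : ℝ) * wt w (E e) = wt w (push E n) := le_antisymm h3 (by linarith)
  have h2' : oW e = n e := by
    have : (oW e : ℝ) * wt w (E e) = (n e : ℝ) * wt w (E e) := le_antisymm h2 (by linarith)
    have := mul_right_cancel₀ (hw e).ne' this
    exact_mod_cast this
  -- all other letters vanish
  have hothers : ∀ x, x ≠ e → n x = 0 := by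
    intro x hx
    rw [wt_push] at h3'
    have hsum : ∑ y ∈ Finset.univ.erase e, (n y : ℝ) * wt w (E y) = 0 := by
      have := Finset.sum_erase_add Finset.univ (fun y => (n y : ℝ) * wt w (E y)) (Finset.mem_univ e)
      linarith
    have hx0 := (Finset.sum_eq_zero_iff_of_nonneg (fun y _ => hterm y (Finset.mem_univ y))).mp hsum x
      (Finset.mem_erase.mpr ⟨hx, Finset.mem_univ x⟩)
    rcases mul_eq_zero.mp hx0 with h | h
    · exact_mod_cast h
    · exact absurd h (hw x).ne'
  -- the direction is `ê`
  have heq_pt : ((oW e : ℤ) • E e) = ((oW ê : ℤ) • E ê) := by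
    apply hgen
    rw [wt_zsmul, wt_zsmul]; push_cast; linarith
  have hoe : 1 ≤ oW e := (hoW e hact).1
  have hee' : e = ê := hE e ê (oW e) (oW ê) hoe heq_pt
  subst hee'
  funext x
  by_cases hx : x = e
  · subst hx; simp [h2']
  · simp [hx, hothers x hx]

/-! ## The two decisive fibre sums -/

/-- **`fib_U` at the pair point.** With `e₁` the lightest and `e₂` the lightest-off-`e₁` active direction of
the separated unit product `U` (orders `oU`), if the pair point `oU(e₁)E_{e₁} + oU(e₂)E_{e₂}` is off-ray then
its `U`-fibre sum is `[s^{o₁}]U_{e₁} · [s^{o₂}]U_{e₂}`. [folklore] -/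
theorem fibU_pairPoint {s D : ℕ} (E : Fin s → Fin 2 → ℤ) (w : Fin 2 → ℝ)
    (hw : ∀ e, 0 < wt w (E e)) (hgen : Function.Injective (wt w))
    (hE : ∀ e e' : Fin s, ∀ k k' : ℕ, 1 ≤ k → (k : ℤ) • E e = (k' : ℤ) • E e' → e = e')
    (U : Fin s → ℂ[X]) (hU0 : ∀ e, (U e).coeff 0 = 1) (hUD : ∀ e, (U e).natDegree ≤ D)
    (oU : Fin s → ℕ) (hoU : ∀ e, Active (U e) → IsOrder (U e) (oU e))
    (e₁ e₂ : Fin s) (hne : e₁ ≠ e₂) (hA1 : Active (U e₁)) (hA2 : Active (U e₂))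
    (h1min : ∀ e, Active (U e) → (oU e₁ : ℝ) * wt w (E e₁) ≤ (oU e : ℝ) * wt w (E e))
    (h2min : ∀ e, e ≠ e₁ → Active (U e) → (oU e₂ : ℝ) * wt w (E e₂) ≤ (oU e : ℝ) * wt w (E e))
    (hray : ¬ OnRay E ((oU e₁ : ℤ) • E e₁ + (oU e₂ : ℤ) • E e₂)) :
    (∑ n ∈ (box s D).filter (fun n => push E n = (oU e₁ : ℤ) • E e₁ + (oU e₂ : ℤ) • E e₂), sepCoeff U n) =
      (U e₁).coeff (oU e₁) * (U e₂).coeff (oU e₂) := by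
  classical
  have hGB := weight_ge_two_lightest E w hw hgen hE U oU hoU e₁ e₂ hne hA2 h1min h2min
  have hwt : wt w ((oU e₁ : ℤ) • E e₁ + (oU e₂ : ℤ) • E e₂) =
      (oU e₁ : ℝ) * wt w (E e₁) + (oU e₂ : ℝ) * wt w (E e₂) := by
    rw [wt_add, wt_zsmul, wt_zsmul]; push_cast; ring
  have hpushc : push E (Pi.single e₁ (oU e₁) + Pi.single e₂ (oU e₂)) =
      (oU e₁ : ℤ) • E e₁ + (oU e₂ : ℤ) • E e₂ := by
    rw [push_add, push_single, push_single]
  rw [Finset.sum_eq_single_of_mem (Pi.single e₁ (oU e₁) + Pi.single e₂ (oU e₂))]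
  · rw [sepCoeff_pair U hU0 hne]
  · exact Finset.mem_filter.mpr ⟨pair_mem_box hne ((hoU e₁ hA1).le_natDegree.trans (hUD e₁))
      ((hoU e₂ hA2).le_natDegree.trans (hUD e₂)), hpushc⟩
  · intro n hn hne'
    obtain ⟨-, hpush⟩ := Finset.mem_filter.mp hn
    by_contra hUn
    by_cases h2 : 2 ≤ (Finset.univ.filter fun x => n x ≠ 0).card
    · have heq : (oU e₁ : ℝ) * wt w (E e₁) + (oU e₂ : ℝ) * wt w (E e₂) = wt w (push E n) := by
        rw [hpush, hwt]
      exact hne' ((hGB n h2 hUn).2 heq)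
    · rcases eq_zero_or_single_of_card_le_one n (by omega) with h0 | ⟨e, k, hk, hnk⟩
      · subst h0
        rw [push_zero] at hpush
        have := congrArg (wt w) hpush
        rw [wt_zero, hwt] at this
        have h1pos : 0 < (oU e₁ : ℝ) * wt w (E e₁) := mul_pos (by exact_mod_cast (hoU e₁ hA1).1) (hw e₁)
        have h2pos : 0 < (oU e₂ : ℝ) * wt w (E e₂) := mul_pos (by exact_mod_cast (hoU e₂ hA2).1) (hw e₂)
        linarith
      · subst hnk
        rw [push_single] at hpush
        exact hray ⟨e, k, hk, hpush.symm⟩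

/-- **`fib_W` at the off-`e₁` ray point.** With `ê` the lightest-off-`e₁` active direction of the separated
unit product `W` (orders `oW`, `ê ≠ e₁`), the `W`-fibre sum at `oW(ê)·E_ê` is `[s^{oW ê}]W_ê`. [folklore] -/
theorem fibW_rayPoint {s D : ℕ} (E : Fin s → Fin 2 → ℤ) (w : Fin 2 → ℝ)
    (hw : ∀ e, 0 < wt w (E e)) (hgen : Function.Injective (wt w))
    (hE : ∀ e e' : Fin s, ∀ k k' : ℕ, 1 ≤ k → (k : ℤ) • E e = (k' : ℤ) • E e' → e = e')
    (W : Fin s → ℂ[X]) (hW0 : ∀ e, (W e).coeff 0 = 1) (hWD : ∀ e, (W e).natDegree ≤ D)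
    (oW : Fin s → ℕ) (hoW : ∀ e, Active (W e) → IsOrder (W e) (oW e))
    (e₁ ê : Fin s) (he1 : ê ≠ e₁) (hA : Active (W ê))
    (hmin : ∀ e, e ≠ e₁ → Active (W e) → (oW ê : ℝ) * wt w (E ê) ≤ (oW e : ℝ) * wt w (E e)) :
    (∑ n ∈ (box s D).filter (fun n => push E n = (oW ê : ℤ) • E ê), sepCoeff W n) = (W ê).coeff (oW ê) := by
  classical
  have hGW := k16_weight_ge_offletter E w hw hgen hE W oW hoW e₁ ê hA hmin
  have hoWe := hoW ê hA
  rw [Finset.sum_eq_single_of_mem (Pi.single ê (oW ê))]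
  · rw [sepCoeff_single W hW0]
  · exact Finset.mem_filter.mpr ⟨single_mem_box ê (hoWe.le_natDegree.trans (hWD ê)), by rw [push_single]⟩
  · intro n hn hne
    obtain ⟨-, hpush⟩ := Finset.mem_filter.mp hn
    by_contra hWn
    by_cases hex : ∃ e, e ≠ e₁ ∧ n e ≠ 0
    · obtain ⟨e, hee, hne0⟩ := hex
      have heq : (oW ê : ℝ) * wt w (E ê) = wt w (push E n) := by
        rw [hpush, wt_zsmul]; push_cast; ring
      exact hne ((hGW n hWn e hee hne0).2 heq)
    · push Not at hex
      have hn1 := eq_single_of_forall_ne e₁ n hex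
      rw [hn1, push_single] at hpush
      rcases Nat.eq_zero_or_pos (n e₁) with h0 | hpos
      · rw [h0] at hpush
        have := congrArg (wt w) hpush
        rw [wt_zsmul, wt_zsmul] at this
        push_cast at this
        have hpos' : 0 < (oW ê : ℝ) * wt w (E ê) := mul_pos (by exact_mod_cast hoWe.1) (hw ê)
        linarith
      · exact he1 (hE e₁ ê (n e₁) (oW ê) hpos hpush).symm

end Summit.ValiantsHypothesis.ValiantsHypothesis.Theorems.NewtonTauWeakFixedK3k16

end
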